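import Summits.ValiantsHypothesis.ValiantsHypothesis.Theorems.FifoMatchingAv231Perms
import HarnessLib

/-!
# The 231-avoiding block sum satisfies the DP (support for `FifoMatching.Av231InVP`, step 3)

For every solution `R` of the block DP
`R p v m = Σ_{a<m} x_{p+a,v+m-1} R p v a R (p+a+1) (v+a) (m-1-a)`, `R p v 0 = 1`, the weighted sum
over the 231-avoiding bijections `[p,p+m) → [v,v+m)` equals `R p v m` (`sum_awt_eq`): fibre over
the position of the maximum (`exists_top`), then the bijection `f ↦ (f|left, f|right)` with inverse
`aglue` of `FifoMatchingAv231Perms.lean`. [folklore]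
-/

noncomputable section

-- layout Summits/ValiantsHypothesis/ValiantsHypothesis forces the duplicated namespace component
set_option linter.dupNamespace false

namespace Summit.ValiantsHypothesis.ValiantsHypothesis.Theorems.FifoMatching

open MvPolynomial

universe u

variable {k : Type u} [CommSemiring k] {N : ℕ}

/-! ### The block sum satisfies the DP -/

section Sum

variable {p v : ℕ}

open scoped Classical in
/-- The empty block: only the identity, of weight one. [folklore] -/
theorem sum_awt_zero (p v : ℕ) :
    ∑ f ∈ Finset.univ.filter (fun f : Fin N → Fin N => IsAvOn p v 0 f), awt k p 0 f = 1 := by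
  have hS : Finset.univ.filter (fun f : Fin N → Fin N => IsAvOn p v 0 f) = {id} := by
    ext f
    simp only [Finset.mem_filter, Finset.mem_univ, true_and, Finset.mem_singleton]
    constructor
    · intro h; funext x; exact h.1 x (by omega)
    · rintro rfl
      refine ⟨fun x _ => rfl, fun x h1 h2 => by omega, fun x y _ h2 _ _ _ => by omega,
        fun x y z hx hz hxy hyz _ _ => ?_⟩
      have h1 : (x : ℕ) < (y : ℕ) := hxy
      have h2 : (y : ℕ) < (z : ℕ) := hyz
      omega
  rw [hS, Finset.sum_singleton]
  unfold awt
  exact Finset.prod_eq_one fun x _ => by rw [if_neg (by omega)]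

open scoped Classical in
/-- **Split at the maximum, as a sum identity:** the weighted sum over the 231-avoiding bijections
of a block equals every solution `R` of the block DP
`R p v m = Σ_{a<m} x_{p+a,v+m-1} R p v a R (p+a+1) (v+a) (m-1-a)`, `R p v 0 = 1`. [folklore] -/
theorem sum_awt_eq (R : ℕ → ℕ → ℕ → MvPolynomial (Fin N × Fin N) k)
    (xN : ℕ → ℕ → MvPolynomial (Fin N × Fin N) k)
    (hx : ∀ (i a : ℕ) (hi : i < N) (ha : a < N), xN i a = X (⟨i, hi⟩, ⟨a, ha⟩))
    (hR0 : ∀ p v, R p v 0 = 1)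
    (hR : ∀ p v m, 0 < m → p + m ≤ N → v + m ≤ N →
      R p v m = ∑ a ∈ Finset.range m,
        xN (p + a) (v + m - 1) * R p v a * R (p + a + 1) (v + a) (m - 1 - a)) :
    ∀ L m p v, m ≤ L → p + m ≤ N → v + m ≤ N →
      ∑ f ∈ Finset.univ.filter (fun f : Fin N → Fin N => IsAvOn p v m f), awt k p m f =
        R p v m := by
  intro L
  induction L with
  | zero =>
    intro m p v hL hpm hvm
    obtain rfl : m = 0 := by omega
    rw [hR0]; exact sum_awt_zero (k := k) p v
  | succ L ih =>
    intro m p v hL hpm hvm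
    rcases Nat.eq_zero_or_pos m with rfl | hm
    · rw [hR0]; exact sum_awt_zero (k := k) p v
    rw [hR p v m hm hpm hvm]
    -- fibre over the position `p + a` of the maximum
    have step1 : ∑ f ∈ Finset.univ.filter (fun f : Fin N → Fin N => IsAvOn p v m f), awt k p m f =
        ∑ f ∈ Finset.univ.filter (fun f : Fin N → Fin N => IsAvOn p v m f),
          ∑ a ∈ Finset.range m, (if fv f (p + a) = v + m - 1 then awt k p m f else 0) := by
      refine Finset.sum_congr rfl fun f hf => ?_
      simp only [Finset.mem_filter, Finset.mem_univ, true_and] at hf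
      obtain ⟨q, hq1, hq2, hq3⟩ := exists_top hf hm hpm
      rw [Finset.sum_eq_single_of_mem ((q : ℕ) - p) (Finset.mem_range.mpr (by omega))]
      · rw [if_pos]
        rw [show p + ((q : ℕ) - p) = q by omega, fv_of_lt f q.isLt]
        simpa using hq3
      · intro b hb hne
        rw [Finset.mem_range] at hb
        rw [if_neg]
        intro hb'
        apply hne
        rw [fv_of_lt f (show p + b < N by omega)] at hb'
        have := hf.2.2.1 ⟨p + b, by omega⟩ q (by simp) (by simp only; omega) hq1 hq2
          (Fin.ext (by rw [hb', hq3]))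
        have := congrArg Fin.val this
        simp only at this
        omega
    rw [step1, Finset.sum_comm]
    refine Finset.sum_congr rfl fun a ha => ?_
    rw [Finset.mem_range] at ha
    rw [← Finset.sum_filter]
    have hpa : p + a < N := by omega
    have hvm1 : v + m - 1 < N := by omega
    rw [hx (p + a) (v + m - 1) hpa hvm1, ← ih a p v (by omega) (by omega) (by omega),
      ← ih (m - 1 - a) (p + a + 1) (v + a) (by omega) (by omega) (by omega),
      mul_assoc, Finset.sum_mul_sum, Finset.mul_sum]
    simp_rw [Finset.mul_sum]
    rw [← Finset.sum_product']
    -- the bijection `f ↦ (f|left, f|right)` with inverse `aglue`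
    refine Finset.sum_bij'
      (fun f _ => (restrict p (p + a) f, restrict (p + a + 1) (p + m) f))
      (fun ff _ => aglue ⟨p + a, hpa⟩ ⟨v + m - 1, hvm1⟩ ff.1 ff.2) ?_ ?_ ?_ ?_ ?_
    · intro f hf
      simp only [Finset.filter_filter, Finset.mem_filter, Finset.mem_univ, true_and] at hf
      obtain ⟨hf, htop⟩ := hf
      rw [fv_of_lt f hpa] at htop
      simp only [Finset.mem_product, Finset.mem_filter, Finset.mem_univ, true_and]
      exact ⟨isAvOn_restrict_left hf ha hpm htop, isAvOn_restrict_right hf ha hpm htop⟩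
    · intro ff hff
      simp only [Finset.mem_product, Finset.mem_filter, Finset.mem_univ, true_and] at hff
      simp only [Finset.filter_filter, Finset.mem_filter, Finset.mem_univ, true_and]
      refine ⟨isAvOn_aglue ha hpm hvm hff.1 hff.2, ?_⟩
      rw [fv_of_lt _ hpa, aglue_self]
    · intro f hf
      simp only [Finset.filter_filter, Finset.mem_filter, Finset.mem_univ, true_and] at hf
      obtain ⟨hf, htop⟩ := hf
      rw [fv_of_lt f hpa] at htop
      have h := aglue_restrict (q := ⟨p + a, hpa⟩) hf
      rw [show f ⟨p + a, hpa⟩ = ⟨v + m - 1, hvm1⟩ from Fin.ext htop] at h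
      exact h
    · intro ff hff
      simp only [Finset.mem_product, Finset.mem_filter, Finset.mem_univ, true_and] at hff
      exact Prod.ext (restrict_aglue_left rfl hff.1) (restrict_aglue_right rfl ha hff.2)
    · intro f hf
      simp only [Finset.filter_filter, Finset.mem_filter, Finset.mem_univ, true_and] at hf
      obtain ⟨hf, htop⟩ := hf
      rw [fv_of_lt f hpa] at htop
      rw [awt_eq_mul (k := k) (f := f) ha hpm, show f ⟨p + a, hpa⟩ = ⟨v + m - 1, hvm1⟩ from
        Fin.ext htop]
      ring

end Sum

end Summit.ValiantsHypothesis.ValiantsHypothesis.Theorems.FifoMatching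

end
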